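import Summits.PneNP.PneNP.Theorems.ConvexRankGatesLinAlgGateBlindValiantHypothesis

/-!
# Route ConvexRankGates — crux `LinAlgGateBlind` (stmt-PneNP-10681), support:
# the crux re-typed over ONE FIXED FIELD (in particular a finite field: the "tame" re-typing) is still Valiant-hard

Prover seat 1 (`--supports stmt-PneNP-10681`), planner-facing (D-0014). Four line leads
(`Cruxes/LinAlgGateBlind/PICKED.md`), the barrier catalogue (C6/D3: "the tame-GRANK re-typing … is where
content remains") and `ConvexRankGatesLinAlgGateBlindValiantHypothesis.lean` ("does not touch … the
tame-GRANK re-typing") recommend re-typing the GRANK half of the crux TAME — `F = ℚ / 𝔽_q`, matrix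
entries of bit-size `≤ s` — as the escape from barrier C6 (the crux as typed implies Valiant's hypothesis,
`dcPerSuperpolynomial_of_linAlgGateBlind`). This file records, kernel-checked and with NO new definitions
(every hypothesis is written out), that the escape is narrower than stated:

* §1 (`exists_pencil_of_hasDetRepr`): the disprover's certificate is FIELD-PRESERVING — an affine
  determinantal representation over `F` of a polynomial with shadow CLIQUE is one generic-rank test
  `[θ ≤ rank (K₀ + ∑ Xᵢ Kᵢ)]` with data over the SAME `F`.
* §2 (`dcPerSuperpolynomial_of_pencilBlind`, `dc_hcPoly_not_isPBounded_of_pencilBlind`): hence already the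
  single-test floor "eventually no rank test of dimension `≤ m^c` with data over the FIXED field `F`, wired to
  the edges, computes `CLIQUE(m, ⌈m^δ⌉₊)`" implies `DcPerSuperpolynomial F` (char `F ≠ 2`) and
  `VNP_F ⊄ VBP_F` (`dc(HC_n)` over `F` not p-bounded; every `F`).
* §3 (`dcPerSuperpolynomial_of_linAlgGateBlindOver`, `…_zmod_…`, `dc_hcPoly_not_isPBounded_zmod_two_…`):
  the crux with `∃ (F : Type) [Field F]` replaced by one fixed field — a WEAKENING of the crux
  (`blindOver_of_linAlgGateBlind`) — still proves Valiant's hypothesis over that field. Over `ZMod p` every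
  matrix entry has `≤ ⌈log₂ p⌉` bits, so on its `𝔽_q`-branch the tame re-typing is barrier C6 verbatim
  (`p` odd: `DcPerSuperpolynomial (ZMod p)`, Valiant's hypothesis in characteristic `p`, open — the proved
  bound there is quadratic, Cai–Chen–Li 2010; `p = 2`: `VNP ⊄ VBP` over `GF(2)`).

The tame basis written out in full (PERM; GRANK over `ℚ` with integer entries of absolute value `≤ 2^s`;
GRANK over `ZMod p`, `p ≤ 2^s`) is treated in the sequel `ConvexRankGatesLinAlgGateBlindTameRetyping.lean`:
it implies `DcPerSuperpolynomial (ZMod p)` for EVERY odd prime `p`, and on the `ℚ`-branch a bit-bounded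
determinantal lower bound for the clique polynomials (a constant-free Valiant-type separation, open).
Reading for the planner: dropping wild constants removes nothing of C6 unless finite fields are dropped too;
what is left of crux #4 outside algebraic-separation floors is the Hall-cover / LP layer (a corollary of
crux #2, `hallCoverCircuitBlind_of_convexGateBlind`) and the PERM half. [folklore]
-/

set_option linter.dupNamespace false  -- `Summit.PneNP.PneNP.…` is the harness-mandated namespace (summit = sub-problem)

namespace Summit.PneNP.PneNP.Theorems.LinAlgGateBlindFixedField

open Filter Matrix MvPolynomial Literature.Computability.Complexity
open Literature.Computability.AlgebraicComplexity
  (HasDetRepr DcPerSuperpolynomial DcPerSuperpolynomialComplex IsPBounded hcPoly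
    hasDetRepr_determinantalComplexity_holds)
open Summit.PneNP.PneNP.Theorems.LinAlgGateBlind.Negative
  (cliquePoly shadow_cliquePoly_iff detGate_eq_true_iff)
open Summit.PneNP.PneNP.Theorems.LinAlgGateBlindValiant
  (isPBounded_dc_cliquePoly_of_perPoly isPBounded_dc_cliquePoly_of_hcPoly two_le_ceil_rpow_of_two_le)

/- Throughout, "pencil-blindness of `F` at `(m, c, k)`" is the hypothesis, always written out,
  `∀ (d θ n : ℕ), d ≤ m ^ c → ∀ (K₀ : Matrix (Fin d) (Fin d) F) (K : Fin n → Matrix (Fin d) (Fin d) F)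
     (w : Fin n → E(K_m)), ¬ ∀ x, decide (θ ≤ (symbolicMatrix K₀ K fun a => x (w a)).rank) = cliqueFn m k x` :
  NO generic-rank threshold test with data over the FIXED field `F`, dimension `d ≤ m^c`, threshold `θ`,
  its `n` inputs wired to the edges of `K_m` by `w`, computes `CLIQUE(m, k)`; and `dc` is
  `Literature.Computability.AlgebraicComplexity.determinantalComplexity`. -/

noncomputable section

/-! ### §1 The certificate is field-preserving -/

section OneTest

variable {F : Type} [Field F]

/-- **Field-preserving one-gate lemma.** An affine determinantal representation of size `d` OVER `F` of a
polynomial `P` whose monotone shadow is `CLIQUE(m,k)` yields generic-rank data `K₀ = A(0)`, `Kᵢ = ∂A/∂Xᵢ`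
OVER THE SAME `F`, dimension `d`, threshold `d`, which — wired to the edges by the enumeration `eE m` —
compute `CLIQUE(m,k)`. [folklore] -/
theorem exists_pencil_of_hasDetRepr {m k d : ℕ} {P : MvPolynomial (Fin (CliqueLPGate.nE m)) F}
    (hP : ∀ x, (∃ s ∈ P.support, ∀ i ∈ s.support, x ((CliqueLPGate.eE m).symm i) = true) ↔
      cliqueFn m k x = true)
    (h : HasDetRepr P d) :
    ∃ (K₀ : Matrix (Fin d) (Fin d) F) (K : Fin (CliqueLPGate.nE m) → Matrix (Fin d) (Fin d) F),
      ∀ x : (⊤ : SimpleGraph (Fin m)).edgeSet → Bool,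
        decide (d ≤ (symbolicMatrix K₀ K fun i => x ((CliqueLPGate.eE m).symm i)).rank) =
          cliqueFn m k x := by
  obtain ⟨A, hA, hdet⟩ := h
  refine ⟨A.map (coeff 0), fun i => A.map (coeff (Finsupp.single i 1)), fun x => ?_⟩
  apply Bool.eq_iff_iff.2
  rw [detGate_eq_true_iff A hA, hdet, hP x]

/-- **Pencil-blindness of `F` forbids determinantal representations over `F`** (support-robust form): if no
rank test over `F` of dimension `≤ m^c` wired to the edges computes `CLIQUE(m,k)`, then no polynomial over
`F` with shadow `CLIQUE(m,k)` has an affine determinantal representation of size `d ≤ m^c`. [folklore] -/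
theorem not_hasDetRepr_of_pencilBlind {m c k : ℕ}
    (h : ∀ (d θ n : ℕ), d ≤ m ^ c → ∀ (K₀ : Matrix (Fin d) (Fin d) F)
      (K : Fin n → Matrix (Fin d) (Fin d) F) (w : Fin n → (⊤ : SimpleGraph (Fin m)).edgeSet),
      ¬ ∀ x : (⊤ : SimpleGraph (Fin m)).edgeSet → Bool,
        decide (θ ≤ (symbolicMatrix K₀ K fun a => x (w a)).rank) = cliqueFn m k x)
    {d : ℕ} (hd : d ≤ m ^ c) {P : MvPolynomial (Fin (CliqueLPGate.nE m)) F}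
    (hP : ∀ x, (∃ s ∈ P.support, ∀ i ∈ s.support, x ((CliqueLPGate.eE m).symm i) = true) ↔
      cliqueFn m k x = true) :
    ¬ HasDetRepr P d := fun hrepr => by
  obtain ⟨K₀, K, hK⟩ := exists_pencil_of_hasDetRepr hP hrepr
  exact h d d _ hd K₀ K _ hK

/-- In particular (`k ≥ 2`) pencil-blindness of `F` at `(m, c, k)` gives `m ^ c < dc (CL_{m,k})` over `F`.
[folklore] -/
theorem lt_dc_cliquePoly_of_pencilBlind {m c k : ℕ} (hk : 2 ≤ k)
    (h : ∀ (d θ n : ℕ), d ≤ m ^ c → ∀ (K₀ : Matrix (Fin d) (Fin d) F)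
      (K : Fin n → Matrix (Fin d) (Fin d) F) (w : Fin n → (⊤ : SimpleGraph (Fin m)).edgeSet),
      ¬ ∀ x : (⊤ : SimpleGraph (Fin m)).edgeSet → Bool,
        decide (θ ≤ (symbolicMatrix K₀ K fun a => x (w a)).rank) = cliqueFn m k x) :
    m ^ c < Literature.Computability.AlgebraicComplexity.determinantalComplexity (cliquePoly m F k) := by
  by_contra hle
  push Not at hle
  exact not_hasDetRepr_of_pencilBlind h hle (shadow_cliquePoly_iff hk)
    (hasDetRepr_determinantalComplexity_holds _)

end OneTest

/-! ### §2 Eventual pencil-blindness of a fixed field implies Valiant's hypothesis over that field -/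

section Headline

variable (F : Type) [Field F]

/-- **Eventual pencil-blindness of `F` at `k = ⌈m^δ⌉₊`, for every `c ≥ 1`, forbids p-bounded
`dc(CL_{n,⌈n^δ⌉₊})` over `F`** (`n ^ c + c ≤ n ^ (c+1)` for `n ≥ 2`). [folklore] -/
theorem not_isPBounded_dc_cliquePoly_of_pencilBlind {δ : ℝ} (hδ : 0 < δ)
    (h : ∀ c : ℕ, 1 ≤ c → ∀ᶠ m : ℕ in atTop, ∀ (d θ n : ℕ), d ≤ m ^ c →
      ∀ (K₀ : Matrix (Fin d) (Fin d) F) (K : Fin n → Matrix (Fin d) (Fin d) F)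
        (w : Fin n → (⊤ : SimpleGraph (Fin m)).edgeSet),
        ¬ ∀ x : (⊤ : SimpleGraph (Fin m)).edgeSet → Bool,
          decide (θ ≤ (symbolicMatrix K₀ K fun a => x (w a)).rank) = cliqueFn m ⌈(m : ℝ) ^ δ⌉₊ x) :
    ¬ IsPBounded fun n =>
      Literature.Computability.AlgebraicComplexity.determinantalComplexity (cliquePoly n F ⌈(n : ℝ) ^ δ⌉₊) := by
  rintro ⟨c, hc⟩
  obtain ⟨n, hn, h2⟩ := ((h (c + 1) (by omega)).and (eventually_ge_atTop 2)).exists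
  have hlt := lt_dc_cliquePoly_of_pencilBlind (two_le_ceil_rpow_of_two_le hδ h2) hn
  have hpow : 2 ^ c ≤ n ^ c := Nat.pow_le_pow_left h2 c
  have hc2 : c < 2 ^ c := Nat.lt_two_pow_self
  have h1 : n ^ c + c ≤ n ^ (c + 1) :=
    calc n ^ c + c ≤ n ^ c + n ^ c := by omega
      _ = 2 * n ^ c := by ring
      _ ≤ n * n ^ c := Nat.mul_le_mul_right _ h2
      _ = n ^ (c + 1) := by ring
  exact absurd ((hc n).trans h1) (not_le.2 hlt)

/-- **Eventual pencil-blindness of a field `F` of characteristic `≠ 2` implies `DcPerSuperpolynomial F`** —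
Valiant's hypothesis over THAT field (pnp.S05), by the `VNP`-completeness of the permanent in
characteristic `≠ 2` (`isPBounded_dc_cliquePoly_of_perPoly`). [folklore] -/
theorem dcPerSuperpolynomial_of_pencilBlind (h2 : ringChar F ≠ 2) {δ : ℝ} (hδ : 0 < δ)
    (h : ∀ c : ℕ, 1 ≤ c → ∀ᶠ m : ℕ in atTop, ∀ (d θ n : ℕ), d ≤ m ^ c →
      ∀ (K₀ : Matrix (Fin d) (Fin d) F) (K : Fin n → Matrix (Fin d) (Fin d) F)
        (w : Fin n → (⊤ : SimpleGraph (Fin m)).edgeSet),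
        ¬ ∀ x : (⊤ : SimpleGraph (Fin m)).edgeSet → Bool,
          decide (θ ≤ (symbolicMatrix K₀ K fun a => x (w a)).rank) = cliqueFn m ⌈(m : ℝ) ^ δ⌉₊ x) :
    DcPerSuperpolynomial F := fun hper =>
  not_isPBounded_dc_cliquePoly_of_pencilBlind F hδ h
    (isPBounded_dc_cliquePoly_of_perPoly F h2 _ (fun _ hn => two_le_ceil_rpow_of_two_le hδ hn) hper)

/-- **Eventual pencil-blindness of ANY field `F` implies `VNP_F ⊄ VBP_F`**: `dc(HC_n)` is not polynomially
bounded over `F` (the Hamiltonian-cycle family is `VNP`-complete in every characteristic,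
`isPBounded_dc_cliquePoly_of_hcPoly`). [folklore] -/
theorem dc_hcPoly_not_isPBounded_of_pencilBlind {δ : ℝ} (hδ : 0 < δ)
    (h : ∀ c : ℕ, 1 ≤ c → ∀ᶠ m : ℕ in atTop, ∀ (d θ n : ℕ), d ≤ m ^ c →
      ∀ (K₀ : Matrix (Fin d) (Fin d) F) (K : Fin n → Matrix (Fin d) (Fin d) F)
        (w : Fin n → (⊤ : SimpleGraph (Fin m)).edgeSet),
        ¬ ∀ x : (⊤ : SimpleGraph (Fin m)).edgeSet → Bool,
          decide (θ ≤ (symbolicMatrix K₀ K fun a => x (w a)).rank) = cliqueFn m ⌈(m : ℝ) ^ δ⌉₊ x) :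
    ¬ IsPBounded fun n =>
      Literature.Computability.AlgebraicComplexity.determinantalComplexity (hcPoly (Fin n) F) := fun hhc =>
  not_isPBounded_dc_cliquePoly_of_pencilBlind F hδ h
    (isPBounded_dc_cliquePoly_of_hcPoly F _ (fun _ hn => two_le_ceil_rpow_of_two_le hδ hn) hhc)

end Headline

/-! ### §3 The crux re-typed over ONE fixed field

`BlindOver F` below always stands for the written-out statement: for some `δ ∈ (0, 1/2)` and every `c`,
eventually in `m`, no circuit with `≤ m^c` gates over `{∧₂, ∨₂} ∪ PERM_{m^c} ∪ {generic-rank threshold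
gates of dimension `≤ m^c` with data in `F`}` computes `CLIQUE(m, ⌈m^δ⌉₊)` — the crux `LinAlgGateBlind`
with its `∃ (F : Type) [Field F]` replaced by the fixed `F`. -/

section FixedField

variable (F : Type) [Field F]

/-- **The fixed-field re-typing is a weakening of the crux**: `LinAlgGateBlind → BlindOver F` for every
field `F` (a gate with data over `F` is a GRANK gate of the crux with witness field `F`). [folklore] -/
theorem blindOver_of_linAlgGateBlind (h : Summit.PneNP.PneNP.Theses.ConvexRankGates.LinAlgGateBlind) :
    ∃ δ : ℝ, 0 < δ ∧ δ < 1 / 2 ∧ ∀ c : ℕ, ∀ᶠ m : ℕ in atTop,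
      ∀ C : Circuit ((⊤ : SimpleGraph (Fin m)).edgeSet),
        C.IsOver ({GateFn.and 2, GateFn.or 2} ∪ {g : GateFn | IsPermGate (m ^ c) g ∨
          ∃ (d θ : ℕ), d ≤ m ^ c ∧ ∃ (K₀ : Matrix (Fin d) (Fin d) F)
            (K : Fin g.1 → Matrix (Fin d) (Fin d) F),
            ∀ v : Fin g.1 → Bool, g.2 v = true ↔ θ ≤ (symbolicMatrix K₀ K v).rank}) →
        C.size ≤ m ^ c → ¬ C.Computes (cliqueFn m ⌈(m : ℝ) ^ δ⌉₊) := by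
  obtain ⟨δ, hδ0, hδ1, hB⟩ := h
  refine ⟨δ, hδ0, hδ1, fun c => ?_⟩
  filter_upwards [hB c] with m hm C hC hs
  refine hm C (hC.mono ?_) hs
  rintro g (hg | hg)
  · exact Or.inl hg
  · rcases hg with hg | ⟨d, θ, hd, K₀, K, hK⟩
    · exact Or.inr (Or.inl hg)
    · exact Or.inr (Or.inr ⟨F, inferInstance, d, θ, hd, K₀, K, hK⟩)

/-- **`BlindOver F` gives eventual pencil-blindness of `F`** at every `c` (a rank test wired to the edges is
a size-`1` circuit over the basis, and `1 ≤ m^c` for `m ≥ 1`). [folklore] -/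
theorem pencilBlind_of_blindOver
    (h : ∃ δ : ℝ, 0 < δ ∧ δ < 1 / 2 ∧ ∀ c : ℕ, ∀ᶠ m : ℕ in atTop,
      ∀ C : Circuit ((⊤ : SimpleGraph (Fin m)).edgeSet),
        C.IsOver ({GateFn.and 2, GateFn.or 2} ∪ {g : GateFn | IsPermGate (m ^ c) g ∨
          ∃ (d θ : ℕ), d ≤ m ^ c ∧ ∃ (K₀ : Matrix (Fin d) (Fin d) F)
            (K : Fin g.1 → Matrix (Fin d) (Fin d) F),
            ∀ v : Fin g.1 → Bool, g.2 v = true ↔ θ ≤ (symbolicMatrix K₀ K v).rank}) →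
        C.size ≤ m ^ c → ¬ C.Computes (cliqueFn m ⌈(m : ℝ) ^ δ⌉₊)) :
    ∃ δ : ℝ, 0 < δ ∧ δ < 1 / 2 ∧ ∀ c : ℕ, 1 ≤ c → ∀ᶠ m : ℕ in atTop, ∀ (d θ n : ℕ), d ≤ m ^ c →
      ∀ (K₀ : Matrix (Fin d) (Fin d) F) (K : Fin n → Matrix (Fin d) (Fin d) F)
        (w : Fin n → (⊤ : SimpleGraph (Fin m)).edgeSet),
        ¬ ∀ x : (⊤ : SimpleGraph (Fin m)).edgeSet → Bool,
          decide (θ ≤ (symbolicMatrix K₀ K fun a => x (w a)).rank) = cliqueFn m ⌈(m : ℝ) ^ δ⌉₊ x := by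
  obtain ⟨δ, hδ0, hδ1, hB⟩ := h
  refine ⟨δ, hδ0, hδ1, fun c _ => ?_⟩
  filter_upwards [hB c, eventually_ge_atTop 1] with m hm h1 d θ n hd K₀ K w hcomp
  let B : Set GateFn := {GateFn.and 2, GateFn.or 2} ∪ {g : GateFn | IsPermGate (m ^ c) g ∨
    ∃ (d θ : ℕ), d ≤ m ^ c ∧ ∃ (K₀ : Matrix (Fin d) (Fin d) F) (K : Fin g.1 → Matrix (Fin d) (Fin d) F),
      ∀ v : Fin g.1 → Bool, g.2 v = true ↔ θ ≤ (symbolicMatrix K₀ K v).rank}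
  let g : GateFn := ⟨n, fun v => decide (θ ≤ (symbolicMatrix K₀ K v).rank)⟩
  have hg : g ∈ B := Or.inr (Or.inr ⟨d, θ, hd, K₀, K, fun v => decide_eq_true_iff⟩)
  obtain ⟨C, hC, hsz, he⟩ := (CktSize.gate (B := B) g hg w).toCircuit
  exact hm C hC (hsz.trans (Nat.one_le_pow _ _ h1)) fun x => (he x).trans (hcomp x)

end FixedField

section Registered

/-- **The crux re-typed over a fixed field `F` of characteristic `≠ 2` implies `DcPerSuperpolynomial F`**
(registered sub-goal `dcPerSuperpolynomial_of_linAlgGateBlindOver` of stmt-PneNP-10681). For `F = ℂ` this is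
Valiant's hypothesis; for `F = 𝔽_p` (`p` odd) it is Valiant's hypothesis in characteristic `p`, although every
matrix entry over `𝔽_p` has bit-size `≤ ⌈log₂ p⌉` (the tame restriction is idle there). [folklore] -/
theorem dcPerSuperpolynomial_of_linAlgGateBlindOver : ∀ (F : Type) [Field F], ringChar F ≠ 2 → (∃ δ : ℝ, 0 < δ ∧ δ < 1 / 2 ∧ ∀ c : ℕ, ∀ᶠ m : ℕ in atTop, ∀ C : Circuit ((⊤ : SimpleGraph (Fin m)).edgeSet), C.IsOver ({GateFn.and 2, GateFn.or 2} ∪ {g : GateFn | IsPermGate (m ^ c) g ∨ ∃ (d θ : ℕ), d ≤ m ^ c ∧ ∃ (K₀ : Matrix (Fin d) (Fin d) F) (K : Fin g.1 → Matrix (Fin d) (Fin d) F), ∀ v : Fin g.1 → Bool, g.2 v = true ↔ θ ≤ (symbolicMatrix K₀ K v).rank}) → C.size ≤ m ^ c → ¬ C.Computes (cliqueFn m ⌈(m : ℝ) ^ δ⌉₊)) → DcPerSuperpolynomial F := by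
  intro F _ h2 h
  obtain ⟨δ, hδ0, -, hB⟩ := pencilBlind_of_blindOver F h
  exact dcPerSuperpolynomial_of_pencilBlind F h2 hδ0 hB

/-- **The crux re-typed over ANY fixed field `F` implies `VNP_F ⊄ VBP_F`** (registered sub-goal
`dc_hcPoly_not_isPBounded_of_linAlgGateBlindOver` of stmt-PneNP-10681): `dc(HC_n)` over `F` is not
polynomially bounded — characteristic `2` included. [folklore] -/
theorem dc_hcPoly_not_isPBounded_of_linAlgGateBlindOver : ∀ (F : Type) [Field F], (∃ δ : ℝ, 0 < δ ∧ δ < 1 / 2 ∧ ∀ c : ℕ, ∀ᶠ m : ℕ in atTop, ∀ C : Circuit ((⊤ : SimpleGraph (Fin m)).edgeSet), C.IsOver ({GateFn.and 2, GateFn.or 2} ∪ {g : GateFn | IsPermGate (m ^ c) g ∨ ∃ (d θ : ℕ), d ≤ m ^ c ∧ ∃ (K₀ : Matrix (Fin d) (Fin d) F) (K : Fin g.1 → Matrix (Fin d) (Fin d) F), ∀ v : Fin g.1 → Bool, g.2 v = true ↔ θ ≤ (symbolicMatrix K₀ K v).rank}) → C.size ≤ m ^ c → ¬ C.Computes (cliqueFn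 m ⌈(m : ℝ) ^ δ⌉₊)) → ¬ IsPBounded fun n => Literature.Computability.AlgebraicComplexity.determinantalComplexity (hcPoly (Fin n) F) := by
  intro F _ h
  obtain ⟨δ, hδ0, -, hB⟩ := pencilBlind_of_blindOver F h
  exact dc_hcPoly_not_isPBounded_of_pencilBlind F hδ0 hB

end Registered

section Instances

/-- **Prime fields (the `𝔽_q`-branch of the tame re-typing).** The crux re-typed over `ZMod p`, `p` an odd
prime — GRANK data with entries in `{0, …, p-1}` — implies `DcPerSuperpolynomial (ZMod p)`: Valiant's
hypothesis in characteristic `p`. [folklore] -/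
theorem dcPerSuperpolynomial_zmod_of_linAlgGateBlindOver (p : ℕ) [Fact p.Prime] (hp : p ≠ 2)
    (h : ∃ δ : ℝ, 0 < δ ∧ δ < 1 / 2 ∧ ∀ c : ℕ, ∀ᶠ m : ℕ in atTop,
      ∀ C : Circuit ((⊤ : SimpleGraph (Fin m)).edgeSet),
        C.IsOver ({GateFn.and 2, GateFn.or 2} ∪ {g : GateFn | IsPermGate (m ^ c) g ∨
          ∃ (d θ : ℕ), d ≤ m ^ c ∧ ∃ (K₀ : Matrix (Fin d) (Fin d) (ZMod p))
            (K : Fin g.1 → Matrix (Fin d) (Fin d) (ZMod p)),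
            ∀ v : Fin g.1 → Bool, g.2 v = true ↔ θ ≤ (symbolicMatrix K₀ K v).rank}) →
        C.size ≤ m ^ c → ¬ C.Computes (cliqueFn m ⌈(m : ℝ) ^ δ⌉₊)) :
    DcPerSuperpolynomial (ZMod p) :=
  dcPerSuperpolynomial_of_linAlgGateBlindOver (ZMod p) (by rwa [ZMod.ringChar_zmod_n]) h

/-- **`GF(2)`.** The crux re-typed over `ZMod 2` (one-bit entries; the field of the route's Hanani–Tutte and
XOR-SAT capture witnesses) implies `VNP ⊄ VBP` over `GF(2)`: `dc(HC_n)` over `ZMod 2` is not polynomially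
bounded (the permanent form of Valiant's hypothesis is void in characteristic `2`). [folklore] -/
theorem dc_hcPoly_not_isPBounded_zmod_two_of_linAlgGateBlindOver
    (h : ∃ δ : ℝ, 0 < δ ∧ δ < 1 / 2 ∧ ∀ c : ℕ, ∀ᶠ m : ℕ in atTop,
      ∀ C : Circuit ((⊤ : SimpleGraph (Fin m)).edgeSet),
        C.IsOver ({GateFn.and 2, GateFn.or 2} ∪ {g : GateFn | IsPermGate (m ^ c) g ∨
          ∃ (d θ : ℕ), d ≤ m ^ c ∧ ∃ (K₀ : Matrix (Fin d) (Fin d) (ZMod 2))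
            (K : Fin g.1 → Matrix (Fin d) (Fin d) (ZMod 2)),
            ∀ v : Fin g.1 → Bool, g.2 v = true ↔ θ ≤ (symbolicMatrix K₀ K v).rank}) →
        C.size ≤ m ^ c → ¬ C.Computes (cliqueFn m ⌈(m : ℝ) ^ δ⌉₊)) :
    ¬ IsPBounded fun n =>
      Literature.Computability.AlgebraicComplexity.determinantalComplexity (hcPoly (Fin n) (ZMod 2)) :=
  dc_hcPoly_not_isPBounded_of_linAlgGateBlindOver (ZMod 2) h

/-- **`ℂ`.** The crux re-typed over `ℂ` alone already implies the tree's registered open statement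
`DcPerSuperpolynomialComplex` (Valiant 1979; Landsberg 2017, Conj. 1.2.4.2). [folklore] -/
theorem dcPerSuperpolynomialComplex_of_linAlgGateBlindOver
    (h : ∃ δ : ℝ, 0 < δ ∧ δ < 1 / 2 ∧ ∀ c : ℕ, ∀ᶠ m : ℕ in atTop,
      ∀ C : Circuit ((⊤ : SimpleGraph (Fin m)).edgeSet),
        C.IsOver ({GateFn.and 2, GateFn.or 2} ∪ {g : GateFn | IsPermGate (m ^ c) g ∨
          ∃ (d θ : ℕ), d ≤ m ^ c ∧ ∃ (K₀ : Matrix (Fin d) (Fin d) ℂ)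
            (K : Fin g.1 → Matrix (Fin d) (Fin d) ℂ),
            ∀ v : Fin g.1 → Bool, g.2 v = true ↔ θ ≤ (symbolicMatrix K₀ K v).rank}) →
        C.size ≤ m ^ c → ¬ C.Computes (cliqueFn m ⌈(m : ℝ) ^ δ⌉₊)) :
    DcPerSuperpolynomialComplex :=
  dcPerSuperpolynomial_of_linAlgGateBlindOver ℂ (by rw [ringChar.eq_zero]; decide) h

end Instances

end

end Summit.PneNP.PneNP.Theorems.LinAlgGateBlindFixedField
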